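import Summits.BirchSwinnertonDyer.Rank1Residual.X11b.ShapiroPairs
import HarnessLib

/-!
# BSD rank-≤1 residual cell, class X11a (MULTIPLICATIVE at `p = 5`, rank ZERO), mod-5 image `5S4` (`N < 5·10⁵`):
# `BSD(E,5)` per pair from PUBLISHED theorems + ONE full-`5`-descent certificate line — x11c GEN 39 «GL2C-39» tranche 2, batch 01

HONEST FRAMING (cell `b2b-bsdres-*`, verbatim): prove what is provable now; shrink each hard class
to its core with data; no claim beyond stated classes; COMBINATION classes deleted from PUBLISHED
theorems only, CONSTRUCTION-shaped remainder typed; this is not "finishing BSD". The class stays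
CONSTRUCTION-SHAPED; everything here is PER PAIR; no lane verdict is changed; no named fact; nothing
is booked by this unit (referee A / A2 book).

Unit `b2b-bsdres-x11c` GEN 39 (prover-b2b-bsdres-x11c-g39-0). Universe: the residue cells at `p = 5` of referee A2's state
`pub-bsdpct-r5-g16/scratchA2_state_after_sq38_onAR1040_fold.pkl` (canonical 7f8eeab8) with `5 ∤ #Ш_an` and no rational
5-torsion, listed in `HOME/b2b-bsdres-x11c/gen39/pop/t2_population.json` — at rank one these are the TWO-TAMAGAWA-CARRIER cells
that no Heegner-index road reaches (barrier `Literature.Barriers.BirchSwinnertonDyer.StringentKolyvaginCapsAtMax`). Each pair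
below carries ONE certificate line from x11c GEN 14's full `5`-descent engine `x5desc` (code `HOME/code/b2b-bsdres-x11c/gen39/legD2/`,
byte-identical to gen 14: run_x5.gp ab9e2f95, x5lib.gp c045a852, shapiro5lib.gp 43ff1114, s4lib.gp a6e75461; `JOB_ALLOW_GL2=1`;
method `HOME/b2b-bsdres-x11c/gen14/X5DESC-METHOD.md`): in the degree-24 field `R = ℚ(T')` the Weil-pairing Kummer map `w_*` is
injective (at image `GL₂(𝔽₅)` because `H¹(GL₂(𝔽₅),𝔽₅²) = 0`; at `5S4`/`5Nn` by Maschke), the computed group `Fake(E)` contains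
`w_*Sel⁵(E/ℚ)`, and the row is listed ONLY because `dim Fake(E) = rank` — so `#Sel^(5)(E/ℚ) = 5^{rank}` exactly (at rank one the
Cremona generator maps to the non-zero element, in `Fake`, exponent vector uniquely determined by quintic characters);
`5`-saturation of `R(S,5)` and the Galois action PROVED by characters; the class group of `R` is PARI's under GRH UNLESS the
docstring says EXACT(analytic CNF): then `ord₅ h(R)` is CERTIFIED by unit bsd-jet eng-2's ENGINE C run byte-identical
(`c1data.gp` d42f9cf7, `c1cert.py` v2.1 440b2acd; method `pub/bsd-jet/pilot/eng-2/Z5S4/roads-g3/C/ENGINE-C-METHOD.md`; applicable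
verbatim because `R/R₀` is cyclic quartic over the sextic line field `R₀` — `HOME/b2b-bsdres-x11c/gen39/` offer memo §(ii)).
Runs of record: kits j308349, j308352; certificate bodies `HOME/b2b-bsdres-x11c/gen39/harvest/certs/`; rows `gen39/harvest/rows39t2.json`.

What enters the kernel per pair is ONE line: `hSel : #Sel^(5)(E/ℚ) = 5 ^ r_an` of the tree's class-free consumer
`Typed.bsdp_of_card_selmerGroup_eq_pow_analyticRank` through x11c gen 12's `X11b.bsdp_of_ainvs_of_card_selmerGroup`
(GZK `hGZK`, `r_an ≤ 1`, `p ∤ #Ш_an`; `Δ ≠ 0` by `decide`). Non-kernel inputs per pair: `r_an`, `#Ш_an` (Cremona; the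
cell's engines) and the certificate line. No Tamagawa / index / image hypothesis. References: Schaefer–Stoll, Trans. AMS 356
(2004); Silverman, *AEC* X.1, X.4 [SilvermanAEC2009]; Sutherland, Forum Math. Sigma 4 (2016); Miller, LMS JCM 14 (2011) §1
[Miller2011LMS]; Cremona's tables [Cremona2006].
-/

set_option autoImplicit false

noncomputable section

open scoped Classical

open WeierstrassCurve Literature.NumberTheory.EllipticCurves
  Literature.NumberTheory.EllipticCurves.Rank1Residual
  Literature.NumberTheory.EllipticCurves.Rank1Residual.Typed
  Literature.NumberTheory.EllipticCurves.Rank1Residual.X11RankOneCertificates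
  Summit.BirchSwinnertonDyer.Rank1Residual.X11b

namespace Summit.BirchSwinnertonDyer.Rank1Residual.X11a

/-- **`BSD(E,5)` for `51840bd1`** [GRH] (`N = 51840`, `5 ∥ N` (non-split multiplicative); Cremona model `[0, 0, 0, -5508, 237168]`; `ρ̄_{E,5}` = `5S4` (subfield degrees {1,3,6,12,24}); rank `0`; `#T = 1`, `∏c = 2`)
from GZK and the certificate line `#Sel^(5)(E/ℚ) = 5 ^ r_an`: full `5`-descent (x11c `x5desc`, kit j308349) in `R = ℚ(T')`,
`[R:ℚ] = 24`, `|d_R| ≈ 10^46`, `S = {2, 3, 5}`, `Cl(R) = [1, []]` under GRH, `20` generators of `R(S,5)` (`5`-saturated: `[1, 144, 20]`),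
`δ`-eigenspace of dimension `3`, `K_S(R) = 0`, all local targets reached, Galois action PROVED by characters,
**`dim Fake(E) = 0 = rank`** ⟹ **`#Sel^(5)(E/ℚ) = 1`** (so `Ш(E/ℚ)[5] = 0`), mode GRH.
Kernel: `Δ ≠ 0`. Binders: `hGZK`, `r_an ≤ 1`, `#Ш_an` a `5`-unit, `hSel`.
[cite: Miller2011LMS, §1 and Def. 1.1] [cite: Cremona2006, Table 1 (Cremona label 51840bd1)] -/
theorem bsdp_g51840bd1 (hGZK : rank_eq_analyticRank_of_analyticRank_le_one)
    (W : WeierstrassCurve ℚ) (hW : W = ⟨0, 0, 0, -5508, 237168⟩)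
    (hr : W.analyticRank ≤ 1) {q : ℚ} (hq : shaAn W = (q : ℂ)) (hv : padicValRat 5 q = 0)
    (hSel : Nat.card (W.selmerGroup (5 : ℤ)) = 5 ^ W.analyticRank) : BSDp W 5 := by
  subst hW
  haveI : Fact (Nat.Prime 5) := ⟨by norm_num⟩
  exact bsdp_of_ainvs_of_card_selmerGroup hGZK 0 0 0 (-5508) 237168 (by decide +kernel) 5
    hr hq hv hSel

/-- **`BSD(E,5)` for `115320m1`** [GRH] (`N = 115320`, `5 ∥ N` (non-split multiplicative); Cremona model `[0, -1, 0, -188676, 158121801]`; `ρ̄_{E,5}` = `5S4` (subfield degrees {1,3,6,12,24}); rank `0`; `#T = 1`, `∏c = 2`)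
from GZK and the certificate line `#Sel^(5)(E/ℚ) = 5 ^ r_an`: full `5`-descent (x11c `x5desc`, kit j308349) in `R = ℚ(T')`,
`[R:ℚ] = 24`, `|d_R| ≈ 10^43`, `S = {2, 3, 5, 31}`, `Cl(R) = [3, [3]]` under GRH, `34` generators of `R(S,5)` (`5`-saturated: `[1, 114, 34]`),
`δ`-eigenspace of dimension `6`, `K_S(R) = 0`, all local targets reached, Galois action PROVED by characters,
**`dim Fake(E) = 0 = rank`** ⟹ **`#Sel^(5)(E/ℚ) = 1`** (so `Ш(E/ℚ)[5] = 0`), mode GRH.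
Kernel: `Δ ≠ 0`. Binders: `hGZK`, `r_an ≤ 1`, `#Ш_an` a `5`-unit, `hSel`.
[cite: Miller2011LMS, §1 and Def. 1.1] [cite: Cremona2006, Table 1 (Cremona label 115320m1)] -/
theorem bsdp_g115320m1 (hGZK : rank_eq_analyticRank_of_analyticRank_le_one)
    (W : WeierstrassCurve ℚ) (hW : W = ⟨0, -1, 0, -188676, 158121801⟩)
    (hr : W.analyticRank ≤ 1) {q : ℚ} (hq : shaAn W = (q : ℂ)) (hv : padicValRat 5 q = 0)
    (hSel : Nat.card (W.selmerGroup (5 : ℤ)) = 5 ^ W.analyticRank) : BSDp W 5 := by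
  subst hW
  haveI : Fact (Nat.Prime 5) := ⟨by norm_num⟩
  exact bsdp_of_ainvs_of_card_selmerGroup hGZK 0 (-1) 0 (-188676) 158121801 (by decide +kernel) 5
    hr hq hv hSel

/-- **`BSD(E,5)` for `317520cp1`** [GRH] (`N = 317520`, `5 ∥ N` (non-split multiplicative); Cremona model `[0, 0, 0, -418068, 103982508]`; `ρ̄_{E,5}` = `5S4` (subfield degrees {1,3,6,12,24}); rank `0`; `#T = 1`, `∏c = 6`)
from GZK and the certificate line `#Sel^(5)(E/ℚ) = 5 ^ r_an`: full `5`-descent (x11c `x5desc`, kit j308352) in `R = ℚ(T')`,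
`[R:ℚ] = 24`, `|d_R| ≈ 10^49`, `S = {2, 3, 5, 7}`, `Cl(R) = [8, [2, 2, 2]]` under GRH, `23` generators of `R(S,5)` (`5`-saturated: `[1, 81, 23]`),
`δ`-eigenspace of dimension `3`, `K_S(R) = 0`, all local targets reached, Galois action PROVED by characters,
**`dim Fake(E) = 0 = rank`** ⟹ **`#Sel^(5)(E/ℚ) = 1`** (so `Ш(E/ℚ)[5] = 0`), mode GRH.
Kernel: `Δ ≠ 0`. Binders: `hGZK`, `r_an ≤ 1`, `#Ш_an` a `5`-unit, `hSel`.
[cite: Miller2011LMS, §1 and Def. 1.1] [cite: Cremona2006, Table 1 (Cremona label 317520cp1)] -/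
theorem bsdp_g317520cp1 (hGZK : rank_eq_analyticRank_of_analyticRank_le_one)
    (W : WeierstrassCurve ℚ) (hW : W = ⟨0, 0, 0, -418068, 103982508⟩)
    (hr : W.analyticRank ≤ 1) {q : ℚ} (hq : shaAn W = (q : ℂ)) (hv : padicValRat 5 q = 0)
    (hSel : Nat.card (W.selmerGroup (5 : ℤ)) = 5 ^ W.analyticRank) : BSDp W 5 := by
  subst hW
  haveI : Fact (Nat.Prime 5) := ⟨by norm_num⟩
  exact bsdp_of_ainvs_of_card_selmerGroup hGZK 0 0 0 (-418068) 103982508 (by decide +kernel) 5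
    hr hq hv hSel

end Summit.BirchSwinnertonDyer.Rank1Residual.X11a

end
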